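import Literature.Combinatorics.Additive.GlobalLevelInequality
import Literature.Combinatorics.AssociationSchemes.JohnsonHarmonics
import HarnessLib

/-!
# The matching-side level-`k` inequality: pulling Keevash–Lifshitz Theorem 1.8 back from `S_n` to perfect matchings

Cell pnp-psdrank (summit PneNP, rung F-N2, route `ChebyshevTracialDesign`, crux stmt-PneNP-19878), the
input «(F2)» of step S4 of the `r = 1` rung (planner p1, N2-SpreadStructure §SNT; prover R1-SKELETON S4):
in the exact bi-mode expansion of a rectangle `X × Y ⊆ (t-cuts) × (perfect matchings)` (kernel file
`Summits/PneNP/PneNP/Theorems/ChebyshevTracialDesignRectangleBiMode.lean`) the matching side enters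
ONLY through the functionals `Π_p(M) = Σ_{T M-closed, |T| = k} p_T` of the harmonic layer vectors `p`
(degree `k = 2κ`) of `1_X`, summed over `M ∈ Y`. This module bounds `Σ_{M ∈ Y} Π_p(M)` for GLOBAL `Y`
by Keevash–Lifshitz's level-`d` inequality on the symmetric group [cite: KeevashLifshitz2023, Thm. 1.8]
(the tree's named fact `GlobalLevelDInequality`, `Literature/Combinatorics/Additive/GlobalLevelInequality.lean`)
pulled back along `S_n → PM_n`, `σ ↦ σ s σ⁻¹` (`s` a reference perfect matching; matchings = fixed-point-free
involutions of `Fin n`, as partner maps). Everything here is PROVED; the only non-Mathlib input is that fact.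

* §1 harmonic vectors (`JohnsonHarmonics.IsHarmonic k p`: homogeneous of degree `k`, `down p = 0`) have
  vanishing superset sums `Σ_{T ⊇ B, |T| = k} p_T = 0` (`|B| < k`) and vanishing TRACE sums
  `Σ_{|T| = k, T ∩ R = B} p_T = 0` (`B ⊆ R`, `|R| < k`; inclusion–exclusion);
* §2 permutations fixing a set `R` pointwise act transitively on the `k`-sets with a given trace on `R`
  (induction on the symmetric difference, by transpositions);
* §3 a function of `σ ∈ S_n` depending only on `σ|_S`, `|S| ≤ k`, lies in `V_{≤ k}` (Def. 1.7);
* §4 `closedSets`, `closedSum k p π = Π_p(π)`, the pull-back `pullVec s k p = (σ ↦ Π_p(σ s σ⁻¹))`, the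
  re-indexing `Π_p(σ s σ⁻¹) = Σ_{S s-closed} p(σ(S))` and hence `pullVec ∈ V_{≤ k}`;
* §5 **`pullVec ⊥ V_{≤ t}` for `t < k`**: on an umvirate `U_{I→J}` the law of `σ(S)` depends only on the
  trace of `σ(S)` on the `≤ t < k` pinned values (left multiplication by the pointwise stabiliser of the
  pinned values preserves the umvirate; §2), so `Σ_{σ ∈ U_{I→J}} p(σ(S))` is a combination of trace sums
  of `p`, which vanish (§1) — the pulled-back functional is a PURE DEGREE-`k` function on `S_n`;
* §6 perfect matchings as `fpfInvolutions n`; any two are conjugate (same cycle type, Mathlib); the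
  fibres `{σ : σ s σ⁻¹ = π}` of the pull-back map all have the size of the centraliser of `s`, whence
  `Σ_{σ : σsσ⁻¹ ∈ Y} g(σsσ⁻¹) = |C(s)|·Σ_{π ∈ Y} g(π)`, `n! = |C(s)|·|PM_n|`, `|Ỹ|/n! = |Y|/|PM_n|`;
* §7 **`closedSum_sq_le`**: for `Y ⊆ PM_n` whose pull-back `Ỹ = pullback s Y` is `r`-global (Def. 1.6,
  tree `IsGlobal`), `ν = |Y|/|PM_n|`, `1 ≤ k ≤ min(⅛ log(1/ν), 10⁻⁵ n)`, `p` harmonic of degree `k`: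
  `(Σ_{π ∈ Y} Π_p(π))² ≤ ν² (C r⁴ k⁻¹ log(1/ν))^k · |PM_n| · Σ_{π ∈ PM_n} Π_p(π)²`
  — modulo `GlobalLevelDInequality` (hypothesis `h`), with its absolute constant `C`;
* §8 **homogeneous ⇒ global** (`isGlobal_pullback`): if `Y` is `τ`-HOMOGENEOUS w.r.t. partial matchings
  (Kupavskii–Zakharov [cite: KupavskiiZakharov2022, §2]; `IsHomogeneousMatchingFamily τ Y`: for every partial
  matching `F`, `|Y ∩ ⟨F⟩|·|PM_n| ≤ τ^{|F|}·|Y|·|⟨F⟩|`) and `τ ≥ 1`, then `pullback s Y` is `√τ`-global: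
  pin sets `pinSet P g` (= umvirates), for `s`-CLOSED `P` the map `σ ↦ σsσ⁻¹` sends `pinSet P g` ONTO the star
  of the forced partial matching (`exists_pin_conj_eq`, via `Equiv.subtypeCongr` and §6 on the complements) with
  fibres the cosets of `C(s) ∩ Fix(P)` (`card_pinSet_fibre`), so the density of `Ỹ` in it is `≤ τ^{|P|/2} ν`; a
  general pin set is partitioned by the values on the `s`-closure `P ∪ s(P)` (`≤ |P|` forced edges), giving
  density `≤ τ^{|P|} ν = (√τ)^{2|P|} ν` — exactly Def. 1.6 (no `1 + O(s²/n)` correction, no density side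
  condition); **`closedSum_sq_le_of_homogeneous`** = §7 with `r⁴ = τ²` under the homogeneity hypothesis: the
  complete «(F2)» of the `r = 1` rung modulo Theorem 1.8.

Dictionary to the kernel files: there a matching is a function `π : Fin n → Fin n` with `π (π x) = x`,
`π x ≠ x` (use `Function.Involutive.toPerm`), and the functional is written
`Σ_{T ∈ univ.filter (fun T => (T.filter fun x => π x ∈ T).card = k)} p T`; for `p` homogeneous of degree
`k` this is `closedSum k p π` (`closedSum_eq_sum_filter_card`). The density/log hypotheses are KL's, on
`ν = |Y|/|PM_n| = |Ỹ|/n!` (`card_pullback_div`); a partial matching is a vertex set `D` with a fixed-point-free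
involution `φ` of `D` (`|D|/2` edges), its star `⟨F⟩ = {π : π|_D = φ}`. presearch: level-`d` inequalities for global functions are printed for
`S_n` only (KL 2023; Filmus–Kindler–Lifshitz–Minzer 2020/24; Keller–Lifshitz–Marcus for product spaces);
none for the perfect-matching scheme — the pull-back is folklore-easy and ours. WHAT THIS IS NOT: no proof
of Theorem 1.8; not the `r = 1` rung; nothing about psd rank; no P-vs-NP content.
-/

noncomputable section

namespace Literature.Combinatorics.AssociationSchemes.MatchingLevelInequality

open Finset Equiv
open scoped InnerProductSpace
open Literature.Combinatorics.AssociationSchemes.JohnsonHarmonics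
open Literature.Combinatorics.Additive.KeevashLifshitz

variable {n : ℕ}

/-! ## §1 Harmonic vectors have vanishing superset and trace sums below their degree -/

/-- Double counting: `(k − |B|) · Σ_{T ⊇ B, |T| = k} p_T = Σ_{i ∉ B} Σ_{T ⊇ B ∪ {i}, |T| = k} p_T`. [folklore] -/
private theorem card_sub_mul_sum_supersets (p : Finset (Fin n) → ℝ) (k : ℕ) (B : Finset (Fin n)) :
    ((k : ℝ) - B.card) * ∑ T ∈ (univ.powersetCard k).filter (fun T => B ⊆ T), p T =
      ∑ i ∈ Bᶜ, ∑ T ∈ (univ.powersetCard k).filter (fun T => insert i B ⊆ T), p T := by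
  -- rewrite the inner condition `insert i B ⊆ T` as `B ⊆ T ∧ i ∈ T`
  have hR : ∀ i ∈ Bᶜ, ∑ T ∈ (univ.powersetCard k).filter (fun T => insert i B ⊆ T), p T =
      ∑ T ∈ (univ.powersetCard k).filter (fun T => B ⊆ T), if i ∈ T then p T else 0 := by
    intro i _
    rw [sum_ite, sum_const_zero, add_zero, filter_filter]
    refine sum_congr ?_ fun _ _ => rfl
    ext T
    simp only [mem_filter, insert_subset_iff]
    tauto
  rw [sum_congr rfl hR, sum_comm]
  rw [mul_sum]
  refine sum_congr rfl fun T hT => ?_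
  have hBT : B ⊆ T := (mem_filter.1 hT).2
  have hTk : T.card = k := (mem_powersetCard.1 (mem_filter.1 hT).1).2
  rw [← sum_filter, sum_const, nsmul_eq_mul]
  congr 1
  have : Bᶜ.filter (fun i => i ∈ T) = T \ B := by
    ext i; simp [mem_sdiff, and_comm]
  rw [this, card_sdiff_of_subset hBT, Nat.cast_sub (card_le_card hBT), hTk]

/-- For a degree-`k` harmonic vector `p` and `|B| < k`: `Σ_{T ⊇ B, |T| = k} p_T = 0` (iterate `down p = 0`).
[cite: LeePrakashDewolfYuen2016, App. B §B.1 (Ker W_t)] -/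
theorem sum_supersets_eq_zero_of_isHarmonic {k : ℕ} {p : Finset (Fin n) → ℝ} (hp : IsHarmonic k p) :
    ∀ (m : ℕ) (B : Finset (Fin n)), B.card + (m + 1) = k →
      ∑ T ∈ (univ.powersetCard k).filter (fun T => B ⊆ T), p T = 0 := by
  intro m
  induction m with
  | zero =>
    intro B hBk
    -- the `(|B|+1)`-supersets of `B` are the `insert i B`, `i ∉ B`: the sum is `down p B = 0`
    have hdown : down p B = 0 := by rw [hp.2]; rfl
    rw [down_apply] at hdown
    rw [← hdown]
    symm
    refine sum_nbij (fun i => insert i B) ?_ ?_ ?_ ?_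
    · intro i hi
      rw [mem_compl] at hi
      simp only [mem_filter, mem_powersetCard, subset_univ, true_and]
      exact ⟨by rw [card_insert_of_notMem hi]; omega, subset_insert i B⟩
    · intro i hi j hj hij
      rw [mem_coe, mem_compl] at hi hj
      have hij' : insert i B = insert j B := hij
      have : i ∈ insert j B := by rw [← hij']; exact mem_insert_self i B
      rcases mem_insert.1 this with h | h
      · exact h
      · exact absurd h hi
    · intro T hT
      rw [mem_coe, mem_filter, mem_powersetCard] at hT
      obtain ⟨⟨-, hTk⟩, hBT⟩ := hT
      have hcard : (T \ B).card = 1 := by rw [card_sdiff_of_subset hBT]; omega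
      obtain ⟨i, hi⟩ := card_eq_one.1 hcard
      refine ⟨i, ?_, ?_⟩
      · rw [mem_coe, mem_compl]
        have : i ∈ T \ B := by rw [hi]; exact mem_singleton_self i
        exact (mem_sdiff.1 this).2
      · rw [← union_sdiff_of_subset hBT, hi]; ext x; simp
    · intro i _; rfl
  | succ m ih =>
    intro B hBk
    have hmul := card_sub_mul_sum_supersets p k B
    have hzero : ∑ i ∈ Bᶜ, ∑ T ∈ (univ.powersetCard k).filter (fun T => insert i B ⊆ T), p T = 0 := by
      refine sum_eq_zero fun i hi => ?_
      rw [mem_compl] at hi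
      exact ih (insert i B) (by rw [card_insert_of_notMem hi]; omega)
    rw [hzero] at hmul
    have hne : ((k : ℝ) - B.card) ≠ 0 := by
      have : (B.card : ℝ) + (m + 2) = k := by exact_mod_cast (show B.card + (m + 2) = k by omega)
      linarith
    exact (mul_eq_zero.1 hmul).resolve_left hne

/-- Corollary: `|B| < k` ⇒ `Σ_{T ⊇ B, |T| = k} p_T = 0`. [cite: LeePrakashDewolfYuen2016, App. B §B.1 (Ker W_t)] -/
theorem sum_supersets_eq_zero_of_card_lt {k : ℕ} {p : Finset (Fin n) → ℝ} (hp : IsHarmonic k p)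
    {B : Finset (Fin n)} (hB : B.card < k) :
    ∑ T ∈ (univ.powersetCard k).filter (fun T => B ⊆ T), p T = 0 :=
  sum_supersets_eq_zero_of_isHarmonic hp (k - B.card - 1) B (by omega)

/-- **Trace sums vanish**: for a degree-`k` harmonic `p`, a set `R` with `|R| < k` and `B ⊆ R`,
`Σ_{|T| = k, T ∩ R = B} p_T = 0` (inclusion–exclusion from the superset sums).
[cite: LeePrakashDewolfYuen2016, App. B §B.1 (Ker W_t)] -/
theorem sum_trace_eq_zero {k : ℕ} {p : Finset (Fin n) → ℝ} (hp : IsHarmonic k p) :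
    ∀ (m : ℕ) (B R : Finset (Fin n)), B ⊆ R → R.card < k → (R \ B).card = m →
      ∑ T ∈ (univ.powersetCard k).filter (fun T => T ∩ R = B), p T = 0 := by
  intro m
  induction m with
  | zero =>
    intro B R hBR hRk hm
    have hRB : R = B := by
      have : R \ B = ∅ := card_eq_zero.1 hm
      exact (subset_antisymm (sdiff_eq_empty_iff_subset.1 this) hBR)
    subst hRB
    have : (univ.powersetCard k).filter (fun T : Finset (Fin n) => T ∩ R = R) =
        (univ.powersetCard k).filter (fun T => R ⊆ T) := by
      refine filter_congr fun T _ => ?_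
      exact inter_eq_right
    rw [this]
    exact sum_supersets_eq_zero_of_card_lt hp hRk
  | succ m ih =>
    intro B R hBR hRk hm
    obtain ⟨x, hx⟩ : (R \ B).Nonempty := card_pos.1 (by omega)
    have hxR : x ∈ R := (mem_sdiff.1 hx).1
    have hxB : x ∉ B := (mem_sdiff.1 hx).2
    -- split `{T : T ∩ (R \ {x}) = B}` according to `x ∈ T`
    have hsplit : ∑ T ∈ (univ.powersetCard k).filter (fun T => T ∩ R.erase x = B), p T =
        ∑ T ∈ (univ.powersetCard k).filter (fun T => T ∩ R = B), p T +
          ∑ T ∈ (univ.powersetCard k).filter (fun T => T ∩ R = insert x B), p T := by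
      rw [← sum_union]
      · refine sum_congr ?_ fun _ _ => rfl
        ext T
        simp only [mem_union, mem_filter]
        constructor
        · rintro ⟨hT, hTR⟩
          by_cases hxT : x ∈ T
          · refine Or.inr ⟨hT, ?_⟩
            rw [← insert_erase hxR, inter_insert_of_mem hxT, hTR]
          · refine Or.inl ⟨hT, ?_⟩
            rw [← insert_erase hxR, inter_insert_of_notMem hxT, hTR]
        · rintro (⟨hT, hTR⟩ | ⟨hT, hTR⟩)
          · refine ⟨hT, ?_⟩
            have : T ∩ R.erase x = (T ∩ R).erase x := by
              ext y; simp only [mem_inter, mem_erase]; tauto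
            rw [this, hTR, erase_eq_of_notMem hxB]
          · refine ⟨hT, ?_⟩
            have : T ∩ R.erase x = (T ∩ R).erase x := by
              ext y; simp only [mem_inter, mem_erase]; tauto
            rw [this, hTR, erase_insert hxB]
      · rw [disjoint_filter]
        intro T _ h1 h2
        rw [h1] at h2
        exact hxB (by rw [h2]; exact mem_insert_self x B)
    have h1 : ∑ T ∈ (univ.powersetCard k).filter (fun T => T ∩ R.erase x = B), p T = 0 :=
      ih B (R.erase x) (fun y hy => mem_erase.2 ⟨fun h => hxB (h ▸ hy), hBR hy⟩)
        (lt_of_le_of_lt (card_erase_le) hRk)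
        (by
          have : R.erase x \ B = (R \ B).erase x := by ext y; simp only [mem_sdiff, mem_erase]; tauto
          rw [this, card_erase_of_mem hx, hm]; rfl)
    have h2 : ∑ T ∈ (univ.powersetCard k).filter (fun T => T ∩ R = insert x B), p T = 0 :=
      ih (insert x B) R (insert_subset hxR hBR) hRk
        (by
          have : R \ insert x B = (R \ B).erase x := by ext y; simp only [mem_sdiff, mem_erase, mem_insert]; tauto
          rw [this, card_erase_of_mem hx, hm]; rfl)
    linarith

/-! ## §2 Permutations fixing a set act transitively on sets with a given trace -/

/-- The image of a set under a transposition exchanging a member with a non-member. [folklore] -/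
private theorem image_swap_eq {T : Finset (Fin n)} {a b : Fin n} (ha : a ∈ T) (hb : b ∉ T) :
    T.image (swap a b) = insert b (T.erase a) := by
  ext y
  simp only [mem_image, mem_insert, mem_erase]
  constructor
  · rintro ⟨x, hx, rfl⟩
    by_cases hxa : x = a
    · subst hxa; left; exact swap_apply_left _ _
    · have hxb : x ≠ b := fun h => hb (h ▸ hx)
      right; rw [swap_apply_of_ne_of_ne hxa hxb]; exact ⟨hxa, hx⟩
  · rintro (rfl | ⟨hya, hy⟩)
    · exact ⟨a, ha, swap_apply_left _ _⟩
    · exact ⟨y, hy, swap_apply_of_ne_of_ne hya (fun h => hb (h ▸ hy))⟩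

/-- **Transitivity with a fixed trace.** If `T, T'` are sets of the same size with the same trace on `R`
then some permutation fixing `R` pointwise maps `T` onto `T'` (the pointwise stabiliser of `R` is transitive on such sets).
[cite: KeevashLifshitz2023, §1.2 (p. 4: umvirates are the cosets of pointwise stabilisers of sets)] -/
theorem exists_perm_fixing_image_eq :
    ∀ (m : ℕ) (R T T' : Finset (Fin n)), (T \ T').card = m → T.card = T'.card → T ∩ R = T' ∩ R →
      ∃ ρ : Perm (Fin n), (∀ x ∈ R, ρ x = x) ∧ T.image ρ = T' := by
  intro m
  induction m with
  | zero =>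
    intro R T T' hm hcard _
    have hsub : T ⊆ T' := sdiff_eq_empty_iff_subset.1 (card_eq_zero.1 hm)
    have heq : T = T' := eq_of_subset_of_card_le hsub (by rw [hcard])
    exact ⟨1, fun x _ => rfl, by rw [heq]; exact image_id⟩
  | succ m ih =>
    intro R T T' hm hcard htr
    obtain ⟨a, ha⟩ : (T \ T').Nonempty := card_pos.1 (by omega)
    have hcard' : (T' \ T).card = m + 1 := by
      have h1 := card_sdiff_add_card_inter T T'
      have h2 := card_sdiff_add_card_inter T' T
      rw [inter_comm] at h2
      omega
    obtain ⟨b, hb⟩ : (T' \ T).Nonempty := card_pos.1 (by omega)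
    rw [mem_sdiff] at ha hb
    -- `a, b ∉ R`
    have haR : a ∉ R := fun h => ha.2 (by
      have : a ∈ T ∩ R := mem_inter.2 ⟨ha.1, h⟩
      rw [htr] at this; exact (mem_inter.1 this).1)
    have hbR : b ∉ R := fun h => hb.2 (by
      have : b ∈ T' ∩ R := mem_inter.2 ⟨hb.1, h⟩
      rw [← htr] at this; exact (mem_inter.1 this).1)
    set T₁ := insert b (T.erase a) with hT₁
    have hT₁img : T.image (swap a b) = T₁ := image_swap_eq ha.1 hb.2
    have hT₁card : T₁.card = T'.card := by
      rw [hT₁, card_insert_of_notMem (fun h => hb.2 (mem_of_mem_erase h)), card_erase_of_mem ha.1]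
      have := card_pos.2 ⟨a, ha.1⟩
      omega
    have hT₁diff : (T₁ \ T').card = m := by
      have : T₁ \ T' = (T \ T').erase a := by
        ext y
        simp only [hT₁, mem_sdiff, mem_insert, mem_erase]
        constructor
        · rintro ⟨rfl | ⟨hya, hyT⟩, hyT'⟩
          · exact absurd hb.1 hyT'
          · exact ⟨hya, hyT, hyT'⟩
        · rintro ⟨hya, hyT, hyT'⟩
          exact ⟨Or.inr ⟨hya, hyT⟩, hyT'⟩
      rw [this, card_erase_of_mem (mem_sdiff.2 ha), hm]; rfl
    have hT₁tr : T₁ ∩ R = T' ∩ R := by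
      rw [← htr, hT₁]
      ext y
      simp only [mem_inter, mem_insert, mem_erase]
      constructor
      · rintro ⟨rfl | ⟨_, hyT⟩, hyR⟩
        · exact absurd hyR hbR
        · exact ⟨hyT, hyR⟩
      · rintro ⟨hyT, hyR⟩
        exact ⟨Or.inr ⟨fun h => haR (h ▸ hyR), hyT⟩, hyR⟩
    obtain ⟨ρ₁, hρ₁R, hρ₁T⟩ := ih R T₁ T' hT₁diff hT₁card hT₁tr
    refine ⟨ρ₁ * swap a b, fun x hx => ?_, ?_⟩
    · have hxa : x ≠ a := fun h => haR (h ▸ hx)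
      have hxb : x ≠ b := fun h => hbR (h ▸ hx)
      rw [Perm.mul_apply, swap_apply_of_ne_of_ne hxa hxb, hρ₁R x hx]
    · rw [← hρ₁T, ← hT₁img, image_image]; rfl

/-! ## §3 Position-juntas lie in `V_{≤ k}` -/

/-- Evaluating a finite linear combination of vectors of `SnSpace n` at a permutation. [folklore] -/
private theorem sum_smul_apply {ι : Type*} (t : Finset ι) (c : ι → ℝ) (v : ι → SnSpace n) (σ : Perm (Fin n)) :
    (∑ i ∈ t, c i • v i) σ = ∑ i ∈ t, c i * v i σ := by
  simp [WithLp.ofLp_sum, Finset.sum_apply]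

/-- Evaluating a finite sum of vectors of `SnSpace n` at a permutation. [folklore] -/
private theorem sum_vec_apply {ι : Type*} (t : Finset ι) (v : ι → SnSpace n) (σ : Perm (Fin n)) :
    (∑ i ∈ t, v i) σ = ∑ i ∈ t, v i σ := by
  simp [WithLp.ofLp_sum, Finset.sum_apply]

/-- **Juntas are low-degree.** A function of `σ ∈ S_n` that only depends on the restriction of `σ` to a
set `S` of at most `k` positions lies in `V_{≤ k}`: it is a combination of the indicators of the
`|S|`-umvirates `U_{I→J}` with `I` an enumeration of `S`. [cite: KeevashLifshitz2023, Def. 1.7 (degree via the dictators `x_{i→j}`)] -/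
theorem mem_degLE_of_forall_eq {k : ℕ} {S : Finset (Fin n)} (hS : S.card ≤ k) (F : SnSpace n)
    (hF : ∀ σ σ' : Perm (Fin n), (∀ x ∈ S, σ x = σ' x) → F σ = F σ') : F ∈ degLE n k := by
  classical
  set t := S.card with ht
  -- enumerate `S`
  let I : Fin t → Fin n := fun i => S.orderEmbOfFin ht.symm i
  have hI : ∀ i, I i ∈ S := fun i => S.orderEmbOfFin_mem ht.symm i
  have hIsurj : ∀ x ∈ S, ∃ i, I i = x := by
    intro x hx
    have : x ∈ Set.range (S.orderEmbOfFin ht.symm) := by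
      rw [Finset.range_orderEmbOfFin]; exact hx
    obtain ⟨i, hi⟩ := this
    exact ⟨i, hi⟩
  -- coefficients
  let c : (Fin t → Fin n) → ℝ := fun J => if h : ∃ σ : Perm (Fin n), ∀ i, σ (I i) = J i then F h.choose else 0
  have hrep : F = ∑ J : Fin t → Fin n, c J • indVec (umvirate I J) := by
    ext σ
    rw [sum_smul_apply]
    simp only [indVec_apply, mem_umvirate, mul_boole]
    have hJ : ∀ J : Fin t → Fin n, (∀ i, σ (I i) = J i) ↔ (fun i => σ (I i)) = J := by
      intro J; constructor
      · intro h; funext i; exact h i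
      · intro h i; rw [← h]
    simp_rw [hJ]
    rw [Finset.sum_ite_eq]
    simp only [mem_univ, if_true]
    -- `c (σ ∘ I) = F σ`
    have hex : ∃ σ' : Perm (Fin n), ∀ i, σ' (I i) = (fun i => σ (I i)) i := ⟨σ, fun i => rfl⟩
    show F σ = c fun i => σ (I i)
    simp only [c, dif_pos hex]
    apply hF
    intro x hx
    obtain ⟨i, rfl⟩ := hIsurj x hx
    exact (hex.choose_spec i).symm
  rw [hrep]
  refine Submodule.sum_mem _ fun J _ => Submodule.smul_mem _ _ ?_
  exact indVec_umvirate_mem_degLE hS I J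

/-! ## §4 The matching-side functional pulled back to `S_n` -/

/-- The `k`-sets of points closed under a permutation `s` (for a fixed-point-free involution: the unions
of `k/2` of its transpositions — the "`M`-closed" `k`-sets of the cell's bi-mode expansion).
[cite: Rothvoss2017, §2 (PDF p. 6)] -/
def closedSets (s : Perm (Fin n)) (k : ℕ) : Finset (Finset (Fin n)) :=
  (univ.powersetCard k).filter (fun S => ∀ x ∈ S, s x ∈ S)

/-- [folklore] -/
private theorem mem_closedSets {s : Perm (Fin n)} {k : ℕ} {S : Finset (Fin n)} :
    S ∈ closedSets s k ↔ S.card = k ∧ ∀ x ∈ S, s x ∈ S := by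
  simp [closedSets, mem_powersetCard]

/-- **The matching-side functional** `Π_p(π) = Σ_{T π-closed, |T| = k} p_T` of a coefficient vector `p`
against a permutation `π` (a perfect matching when `π` is a fixed-point-free involution).
[cite: Rothvoss2017, §2 (PDF p. 6)] -/
def closedSum (k : ℕ) (p : Finset (Fin n) → ℝ) (π : Perm (Fin n)) : ℝ := ∑ T ∈ closedSets π k, p T

/-- **Pull-back to `S_n`**: `G_p(σ) = Π_p(σ s σ⁻¹)`, the functional of the matching `σ s σ⁻¹` obtained by
transporting the reference matching `s` along `σ`. [cite: KeevashLifshitz2023, §1.2 (functions on `S_n`)] -/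
def pullVec (s : Perm (Fin n)) (k : ℕ) (p : Finset (Fin n) → ℝ) : SnSpace n :=
  vec fun σ => closedSum k p (σ * s * σ⁻¹)

/-- Re-indexing: `Π_p(σ s σ⁻¹) = Σ_{S s-closed, |S| = k} p(σ(S))` (the sets closed under the transported matching
`σ s σ⁻¹` are the `σ`-images of the `s`-closed sets). [cite: GodsilMeagher2015, §15.2 (perfect matching scheme: `S_n` acts on perfect matchings)] -/
theorem closedSum_conj (k : ℕ) (p : Finset (Fin n) → ℝ) (s σ : Perm (Fin n)) :
    closedSum k p (σ * s * σ⁻¹) = ∑ S ∈ closedSets s k, p (S.image σ) := by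
  unfold closedSum
  symm
  refine sum_nbij' (fun S => S.image σ) (fun T => T.image ⇑σ⁻¹) ?_ ?_ ?_ ?_ ?_
  · intro S hS
    rw [mem_closedSets] at hS ⊢
    refine ⟨by rw [card_image_of_injective _ σ.injective, hS.1], ?_⟩
    intro y hy
    obtain ⟨x, hx, rfl⟩ := mem_image.1 hy
    have h1 : (σ * s * σ⁻¹) (σ x) = σ (s x) := by simp [Perm.mul_apply]
    rw [h1]
    exact mem_image_of_mem _ (hS.2 x hx)
  · intro T hT
    rw [mem_closedSets] at hT ⊢
    refine ⟨by rw [card_image_of_injective _ σ⁻¹.injective, hT.1], ?_⟩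
    intro y hy
    obtain ⟨x, hx, rfl⟩ := mem_image.1 hy
    have := hT.2 x hx
    have h2 : s (σ⁻¹ x) = σ⁻¹ ((σ * s * σ⁻¹) x) := by simp [Perm.mul_apply]
    rw [h2]
    exact mem_image_of_mem _ this
  · intro S _
    rw [image_image]
    convert image_id (s := S) using 2
    funext x; simp
  · intro T _
    rw [image_image]
    convert image_id (s := T) using 2
    funext x; simp
  · intro S _; rfl

/-- [cite: KeevashLifshitz2023, §1.2] -/
theorem pullVec_apply (s : Perm (Fin n)) (k : ℕ) (p : Finset (Fin n) → ℝ) (σ : Perm (Fin n)) :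
    pullVec s k p σ = ∑ S ∈ closedSets s k, p (S.image σ) := by
  rw [pullVec, vec_apply, closedSum_conj]

/-- **`G_p ∈ V_{≤ k}`**: the pulled-back functional is a sum of `k`-juntas (`σ ↦ p(σ(S))`, `S` fixed).
[cite: KeevashLifshitz2023, Def. 1.7] -/
theorem pullVec_mem_degLE (s : Perm (Fin n)) (k : ℕ) (p : Finset (Fin n) → ℝ) : pullVec s k p ∈ degLE n k := by
  have hrep : pullVec s k p = ∑ S ∈ closedSets s k, vec (fun σ : Perm (Fin n) => p (S.image σ)) := by
    ext σ
    rw [pullVec_apply, sum_vec_apply]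
    rfl
  rw [hrep]
  refine Submodule.sum_mem _ fun S hS => ?_
  refine mem_degLE_of_forall_eq (le_of_eq (mem_closedSets.1 hS).1) _ fun σ σ' hσ => ?_
  show p (S.image σ) = p (S.image σ')
  rw [image_congr (fun x hx => hσ x hx)]

/-! ## §5 Orthogonality to `V_{≤ k−1}`: the junta argument -/

/-- Left multiplication by a permutation fixing the values `J i` preserves the umvirate `U_{I→J}`. [folklore] -/
private theorem mul_mem_umvirate {t : ℕ} {I J : Fin t → Fin n} {ρ σ : Perm (Fin n)}
    (hρ : ∀ i, ρ (J i) = J i) (hσ : σ ∈ umvirate I J) : ρ * σ ∈ umvirate I J := by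
  rw [mem_umvirate] at hσ ⊢
  intro i
  rw [Perm.mul_apply, hσ i, hρ i]

/-- The fibre counts `N(T) = #{σ ∈ U_{I→J} : σ(S) = T}` only depend on the trace `T ∩ J([t])`.
[folklore] -/
private theorem card_fibre_eq_of_trace_eq {t k : ℕ} (I J : Fin t → Fin n) (S : Finset (Fin n))
    {T T' : Finset (Fin n)} (hT : T.card = k) (hT' : T'.card = k)
    (htr : T ∩ univ.image J = T' ∩ univ.image J) :
    ((umvirate I J).filter (fun σ : Perm (Fin n) => S.image ⇑σ = T)).card =
      ((umvirate I J).filter (fun σ : Perm (Fin n) => S.image ⇑σ = T')).card := by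
  classical
  obtain ⟨ρ, hρR, hρT⟩ := exists_perm_fixing_image_eq (T \ T').card (univ.image J) T T' rfl
    (by rw [hT, hT']) htr
  have hρJ : ∀ i, ρ (J i) = J i := fun i => hρR (J i) (mem_image_of_mem _ (mem_univ i))
  refine card_nbij' (fun σ => ρ * σ) (fun σ => ρ⁻¹ * σ) ?_ ?_ ?_ ?_
  · intro σ hσ
    rw [mem_coe, mem_filter] at hσ ⊢
    refine ⟨mul_mem_umvirate hρJ hσ.1, ?_⟩
    rw [← hρT, ← hσ.2, image_image]; rfl
  · intro σ hσ
    rw [mem_coe, mem_filter] at hσ ⊢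
    have hρJ' : ∀ i, ρ⁻¹ (J i) = J i := by
      intro i
      conv_lhs => rw [← hρJ i]
      simp
    refine ⟨mul_mem_umvirate hρJ' hσ.1, ?_⟩
    have : T = T'.image ⇑ρ⁻¹ := by
      rw [← hρT, image_image]
      convert (image_id (s := T)).symm using 2
      funext x; simp
    rw [this, ← hσ.2, image_image]; rfl
  · intro σ _; simp [← mul_assoc]
  · intro σ _; simp [← mul_assoc]

/-- **Core vanishing**: for a degree-`k` harmonic `p`, a `k`-set `S` of positions and ANY umvirate
`U_{I→J}` of size `t < k`, `Σ_{σ ∈ U_{I→J}} p(σ(S)) = 0` — the law of `σ(S)` on the umvirate only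
depends on the trace of `σ(S)` on the `< k` pinned values, and harmonic vectors have vanishing trace sums.
[cite: KeevashLifshitz2023, Def. 1.7] -/
theorem sum_umvirate_image_eq_zero {t k : ℕ} (htk : t < k) (I J : Fin t → Fin n)
    {p : Finset (Fin n) → ℝ} (hp : IsHarmonic k p) {S : Finset (Fin n)} (hS : S.card = k) :
    ∑ σ ∈ umvirate I J, p (S.image σ) = 0 := by
  classical
  set U := umvirate I J
  set R := (univ : Finset (Fin t)).image J with hR
  have hRk : R.card < k := lt_of_le_of_lt (card_image_le.trans (by simp)) htk
  set N : Finset (Fin n) → ℝ := fun T => ((U.filter (fun σ : Perm (Fin n) => S.image ⇑σ = T)).card : ℝ) with hN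
  -- group by the value of `σ(S)`
  have hgroup : ∑ σ ∈ U, p (S.image σ) = ∑ T ∈ univ.powersetCard k, N T * p T := by
    have : ∀ σ ∈ U, p (S.image ⇑σ) = ∑ T ∈ univ.powersetCard k, if S.image ⇑σ = T then p T else 0 := by
      intro σ _
      rw [sum_ite_eq, if_pos]
      exact mem_powersetCard.2 ⟨subset_univ _, by rw [card_image_of_injective _ σ.injective, hS]⟩
    rw [sum_congr rfl this, sum_comm]
    refine sum_congr rfl fun T _ => ?_
    rw [← sum_filter, sum_const, nsmul_eq_mul]
  rw [hgroup]
  -- group the `k`-sets by their trace on `R`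
  rw [← sum_fiberwise_of_maps_to (g := fun T => T ∩ R) (t := R.powerset)
    (fun T _ => mem_powerset.2 inter_subset_right)]
  refine sum_eq_zero fun B hB => ?_
  have hBR : B ⊆ R := mem_powerset.1 hB
  -- on the fibre `{T : T ∩ R = B}` the count `N` is constant
  by_cases hne : ((univ.powersetCard k).filter (fun T : Finset (Fin n) => T ∩ R = B)).Nonempty
  · obtain ⟨T₀, hT₀⟩ := hne
    have hT₀k : T₀.card = k := (mem_powersetCard.1 (mem_filter.1 hT₀).1).2
    have hconst : ∀ T ∈ (univ.powersetCard k).filter (fun T : Finset (Fin n) => T ∩ R = B), N T * p T = N T₀ * p T := by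
      intro T hT
      have hTk : T.card = k := (mem_powersetCard.1 (mem_filter.1 hT).1).2
      have htr : T ∩ R = T₀ ∩ R := by rw [(mem_filter.1 hT).2, (mem_filter.1 hT₀).2]
      rw [hN]
      simp only
      rw [card_fibre_eq_of_trace_eq I J S hTk hT₀k htr]
    rw [sum_congr rfl hconst, ← mul_sum, sum_trace_eq_zero hp (R \ B).card B R hBR hRk rfl, mul_zero]
  · rw [not_nonempty_iff_eq_empty.1 hne, sum_empty]

/-- **`G_p ⊥ U_{I→J}` for every umvirate of size `t < k`.** [cite: KeevashLifshitz2023, Def. 1.7] -/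
theorem inner_pullVec_indVec_umvirate {t k : ℕ} (htk : t < k) (s : Perm (Fin n)) (I J : Fin t → Fin n)
    {p : Finset (Fin n) → ℝ} (hp : IsHarmonic k p) :
    ⟪pullVec s k p, indVec (umvirate I J)⟫_ℝ = 0 := by
  rw [real_inner_comm, inner_indVec_left]
  simp_rw [pullVec_apply]
  rw [sum_comm]
  refine sum_eq_zero fun S hS => ?_
  exact sum_umvirate_image_eq_zero htk I J hp (mem_closedSets.1 hS).1

/-- **`G_p ⊥ V_{≤ t}` for every `t < k`** (in particular `t = k − 1`): the pulled-back matching-side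
functional of a degree-`k` harmonic vector is a pure degree-`k` function on `S_n`.
[cite: KeevashLifshitz2023, Def. 1.7] -/
theorem inner_pullVec_eq_zero_of_mem_degLE {t k : ℕ} (htk : t < k) (s : Perm (Fin n))
    {p : Finset (Fin n) → ℝ} (hp : IsHarmonic k p) {w : SnSpace n} (hw : w ∈ degLE n t) :
    ⟪pullVec s k p, w⟫_ℝ = 0 := by
  induction hw using Submodule.span_induction with
  | mem v hv =>
    obtain ⟨t', ht', I, J, rfl⟩ := hv
    exact inner_pullVec_indVec_umvirate (lt_of_le_of_lt ht' htk) s I J hp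
  | zero => exact inner_zero_right _
  | add u v _ _ hu hv => rw [inner_add_right, hu, hv, add_zero]
  | smul a u _ hu => rw [inner_smul_right, hu, mul_zero]

/-- Dictionary to the kernel's form of the functional: for `p` homogeneous of degree `k`,
`Σ_{T : #{x ∈ T : π x ∈ T} = k} p_T = Π_p(π)`. [cite: Rothvoss2017, §2 (PDF p. 6)] -/
theorem closedSum_eq_sum_filter_card {k : ℕ} {p : Finset (Fin n) → ℝ} (hp : IsHomog k p) (π : Perm (Fin n)) :
    ∑ T ∈ univ.filter (fun T : Finset (Fin n) => (T.filter fun x => π x ∈ T).card = k), p T = closedSum k p π := by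
  classical
  unfold closedSum closedSets
  -- both sides are the sum over `k`-sets that are `π`-closed; other sets in the left filter have `p T = 0`
  rw [← sum_filter_add_sum_filter_not (univ.filter fun T : Finset (Fin n) => (T.filter fun x => π x ∈ T).card = k)
    (fun T => T.card = k)]
  have hzero : ∑ T ∈ (univ.filter fun T : Finset (Fin n) => (T.filter fun x => π x ∈ T).card = k).filter
      (fun T => ¬ T.card = k), p T = 0 :=
    sum_eq_zero fun T hT => hp T (mem_filter.1 hT).2
  rw [hzero, add_zero]
  refine sum_congr ?_ fun _ _ => rfl
  ext T
  simp only [mem_filter, mem_univ, true_and, mem_powersetCard, subset_univ]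
  constructor
  · rintro ⟨hf, hT⟩
    refine ⟨hT, fun x hx => ?_⟩
    have hsub : T.filter (fun x => π x ∈ T) = T := eq_of_subset_of_card_le (filter_subset _ _) (by rw [hf, hT])
    have : x ∈ T.filter (fun x => π x ∈ T) := by rw [hsub]; exact hx
    exact (mem_filter.1 this).2
  · rintro ⟨hT, hcl⟩
    refine ⟨?_, hT⟩
    rw [filter_true_of_mem hcl, hT]

/-! ## §6 Perfect matchings as fixed-point-free involutions; the map `σ ↦ σ s σ⁻¹` -/

/-- The fixed-point-free involutions of `Fin n` — the perfect matchings of `K_n` (partner maps).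
[cite: Rothvoss2017, §2 (PDF p. 6)] -/
def fpfInvolutions (n : ℕ) : Finset (Perm (Fin n)) :=
  univ.filter (fun π => π * π = 1 ∧ ∀ x, π x ≠ x)

/-- [cite: Rothvoss2017, §2 (PDF p. 6)] -/
theorem mem_fpfInvolutions {π : Perm (Fin n)} : π ∈ fpfInvolutions n ↔ π * π = 1 ∧ ∀ x, π x ≠ x := by
  simp [fpfInvolutions]

/-- Conjugates of a fixed-point-free involution are fixed-point-free involutions. [folklore] -/
private theorem conj_mem_fpfInvolutions {s : Perm (Fin n)} (hs : s ∈ fpfInvolutions n) (σ : Perm (Fin n)) :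
    σ * s * σ⁻¹ ∈ fpfInvolutions n := by
  rw [mem_fpfInvolutions] at hs ⊢
  refine ⟨?_, fun x hx => ?_⟩
  · rw [show σ * s * σ⁻¹ * (σ * s * σ⁻¹) = σ * (s * s) * σ⁻¹ by group, hs.1]; group
  · have : s (σ⁻¹ x) = σ⁻¹ x := by
      have h := congrArg (⇑σ⁻¹) hx
      simpa [Perm.mul_apply] using h
    exact hs.2 _ this

/-- The cycle type of a fixed-point-free involution of `Fin n` is determined by `n`. [folklore] -/
private theorem cycleType_eq_of_mem_fpfInvolutions {s π : Perm (Fin n)} (hs : s ∈ fpfInvolutions n)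
    (hπ : π ∈ fpfInvolutions n) : s.cycleType = π.cycleType := by
  classical
  rw [mem_fpfInvolutions] at hs hπ
  rcases Nat.eq_zero_or_pos n with hn | hn
  · subst hn
    have : ∀ τ : Perm (Fin 0), τ = 1 := fun τ => Subsingleton.elim _ _
    rw [this s, this π]
  · haveI : Fact (Nat.Prime 2) := ⟨Nat.prime_two⟩
    have hord : ∀ τ : Perm (Fin n), τ * τ = 1 → (∀ x, τ x ≠ x) → orderOf τ = 2 := by
      intro τ h1 h2
      refine orderOf_eq_prime (by rw [pow_two, h1]) fun h => ?_
      exact h2 ⟨0, hn⟩ (by rw [h]; rfl)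
    have hsupp : ∀ τ : Perm (Fin n), (∀ x, τ x ≠ x) → τ.support.card = n := by
      intro τ h2
      rw [show τ.support = univ from eq_univ_of_forall fun x => Perm.mem_support.2 (h2 x), card_univ, Fintype.card_fin]
    have hct : ∀ τ : Perm (Fin n), τ * τ = 1 → (∀ x, τ x ≠ x) → ∃ m, τ.cycleType = Multiset.replicate (m + 1) 2 ∧ 2 * (m + 1) = n := by
      intro τ h1 h2
      have hprime : (orderOf τ).Prime := by rw [hord τ h1 h2]; exact Nat.prime_two
      obtain ⟨m, hm⟩ := Perm.cycleType_prime_order hprime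
      rw [hord τ h1 h2] at hm
      refine ⟨m, hm, ?_⟩
      have hsum := τ.sum_cycleType
      rw [hm, Multiset.sum_replicate, hsupp τ h2, smul_eq_mul] at hsum
      omega
    obtain ⟨a, ha, ha'⟩ := hct s hs.1 hs.2
    obtain ⟨b, hb, hb'⟩ := hct π hπ.1 hπ.2
    rw [ha, hb]
    congr 1
    omega

/-- **Any two perfect matchings are conjugate**: for fixed-point-free involutions `s, π` there is `σ` with
`σ s σ⁻¹ = π` (`S_n` is transitive on perfect matchings; here via cycle types).
[cite: GodsilMeagher2015, §15.2 (perfect matching scheme: the perfect matchings form one `S_n`-orbit)] -/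
theorem exists_conj_eq {s π : Perm (Fin n)} (hs : s ∈ fpfInvolutions n) (hπ : π ∈ fpfInvolutions n) :
    ∃ σ : Perm (Fin n), σ * s * σ⁻¹ = π := by
  classical
  have h : IsConj s π := Perm.isConj_iff_cycleType_eq.2 (cycleType_eq_of_mem_fpfInvolutions hs hπ)
  exact isConj_iff.1 h

/-- The permutations transporting `s` to `π`: `{σ : σ s σ⁻¹ = π}`. [folklore] -/
def transporters (s π : Perm (Fin n)) : Finset (Perm (Fin n)) := univ.filter (fun σ => σ * s * σ⁻¹ = π)

/-- **All fibres of `σ ↦ σ s σ⁻¹` have the size of the centraliser of `s`** (they are its left cosets: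
`PM_n ≅ S_n / (S_2 ≀ S_{n/2})`). [cite: GodsilMeagher2015, §15.2 (perfect matchings as the coset space of the stabiliser of one matching)] -/
theorem card_transporters_eq {s π : Perm (Fin n)} (hne : (transporters s π).Nonempty) :
    (transporters s π).card = (transporters s s).card := by
  obtain ⟨σ₀, hσ₀⟩ := hne
  rw [transporters, mem_filter] at hσ₀
  symm
  refine card_nbij' (fun c => σ₀ * c) (fun σ => σ₀⁻¹ * σ) ?_ ?_ ?_ ?_
  · intro c hc
    rw [mem_coe, transporters, mem_filter] at hc ⊢
    refine ⟨mem_univ _, ?_⟩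
    rw [show σ₀ * c * s * (σ₀ * c)⁻¹ = σ₀ * (c * s * c⁻¹) * σ₀⁻¹ by group, hc.2, hσ₀.2]
  · intro σ hσ
    rw [mem_coe, transporters, mem_filter] at hσ ⊢
    refine ⟨mem_univ _, ?_⟩
    rw [show σ₀⁻¹ * σ * s * (σ₀⁻¹ * σ)⁻¹ = σ₀⁻¹ * (σ * s * σ⁻¹) * σ₀ by group, hσ.2, ← hσ₀.2]
    group
  · intro c _; simp
  · intro σ _; simp

/-- **Push-forward of a sum along `σ ↦ σ s σ⁻¹`**: for `Y` a set of perfect matchings and the reference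
matching `s`, `Σ_{σ : σ s σ⁻¹ ∈ Y} g(σ s σ⁻¹) = |C(s)| · Σ_{π ∈ Y} g(π)`.
[cite: GodsilMeagher2015, §15.2 (perfect matchings as the coset space of the stabiliser of one matching)] -/
theorem sum_filter_conj_mem (s : Perm (Fin n)) (hs : s ∈ fpfInvolutions n) {Y : Finset (Perm (Fin n))}
    (hY : Y ⊆ fpfInvolutions n) (g : Perm (Fin n) → ℝ) :
    ∑ σ ∈ univ.filter (fun σ : Perm (Fin n) => σ * s * σ⁻¹ ∈ Y), g (σ * s * σ⁻¹) =
      ((transporters s s).card : ℝ) * ∑ π ∈ Y, g π := by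
  classical
  rw [mul_sum]
  -- fibre over each `π ∈ Y`
  rw [← sum_fiberwise_of_maps_to (s := univ.filter (fun σ : Perm (Fin n) => σ * s * σ⁻¹ ∈ Y)) (t := Y)
    (g := fun σ => σ * s * σ⁻¹) (fun σ hσ => (mem_filter.1 hσ).2)]
  refine sum_congr rfl fun π hπ => ?_
  have hfib : (univ.filter (fun σ : Perm (Fin n) => σ * s * σ⁻¹ ∈ Y)).filter (fun σ => σ * s * σ⁻¹ = π) =
      transporters s π := by
    ext σ
    simp only [transporters, mem_filter, mem_univ, true_and]
    constructor
    · exact fun h => h.2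
    · intro h; exact ⟨by rw [h]; exact hπ, h⟩
  rw [hfib]
  have hval : ∀ σ ∈ transporters s π, g (σ * s * σ⁻¹) = g π := by
    intro σ hσ; rw [(mem_filter.1 hσ).2]
  rw [sum_congr rfl hval, sum_const, nsmul_eq_mul]
  congr 1
  have hne : (transporters s π).Nonempty := by
    obtain ⟨σ, hσ⟩ := exists_conj_eq hs (hY hπ)
    exact ⟨σ, mem_filter.2 ⟨mem_univ _, hσ⟩⟩
  exact_mod_cast card_transporters_eq hne

/-- Counting all of `S_n` along the fibres: `n! = |C(s)| · |PM_n|` (orbit–stabiliser for the perfect matchings).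
[cite: GodsilMeagher2015, §15.2 (perfect matchings as the coset space of the stabiliser of one matching)] -/
theorem factorial_eq_card_mul (s : Perm (Fin n)) (hs : s ∈ fpfInvolutions n) :
    (n.factorial : ℝ) = ((transporters s s).card : ℝ) * (fpfInvolutions n).card := by
  have h := sum_filter_conj_mem s hs (subset_refl _) (fun _ => (1 : ℝ))
  rw [sum_const, sum_const, nsmul_eq_mul, nsmul_eq_mul, mul_one, mul_one] at h
  rw [← h]
  have : univ.filter (fun σ : Perm (Fin n) => σ * s * σ⁻¹ ∈ fpfInvolutions n) = univ := by
    refine eq_univ_of_forall fun σ => mem_filter.2 ⟨mem_univ _, conj_mem_fpfInvolutions hs σ⟩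
  rw [this, card_univ, Fintype.card_perm, Fintype.card_fin]

/-- The pull-back `Ỹ = {σ : σ s σ⁻¹ ∈ Y}` of a set of perfect matchings to `S_n`.
[cite: KeevashLifshitz2023, Def. 1.6 (globalness is tested on this set)] -/
def pullback (s : Perm (Fin n)) (Y : Finset (Perm (Fin n))) : Finset (Perm (Fin n)) :=
  univ.filter (fun σ => σ * s * σ⁻¹ ∈ Y)

/-- `|Ỹ| = |C(s)| · |Y|`. [cite: GodsilMeagher2015, §15.2 (perfect matchings as the coset space of the stabiliser of one matching)] -/
theorem card_pullback (s : Perm (Fin n)) (hs : s ∈ fpfInvolutions n) {Y : Finset (Perm (Fin n))}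
    (hY : Y ⊆ fpfInvolutions n) : ((pullback s Y).card : ℝ) = ((transporters s s).card : ℝ) * Y.card := by
  have h := sum_filter_conj_mem s hs hY (fun _ => (1 : ℝ))
  rw [sum_const, sum_const, nsmul_eq_mul, nsmul_eq_mul, mul_one, mul_one] at h
  exact h

/-- The density of the pull-back is the density of `Y` among perfect matchings: `|Ỹ|/n! = |Y|/|PM_n|` — so the
density and `log(1/μ)` hypotheses of Theorem 1.8 for `Ỹ` are hypotheses on `ν(Y)`.
[cite: KeevashLifshitz2023, Thm. 1.8 (hypotheses on `μ(A)`)] -/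
theorem card_pullback_div (s : Perm (Fin n)) (hs : s ∈ fpfInvolutions n) {Y : Finset (Perm (Fin n))}
    (hY : Y ⊆ fpfInvolutions n) :
    ((pullback s Y).card : ℝ) / n.factorial = (Y.card : ℝ) / (fpfInvolutions n).card := by
  rw [card_pullback s hs hY, factorial_eq_card_mul s hs]
  have hc : (0 : ℝ) < (transporters s s).card := by
    have : (transporters s s).Nonempty := ⟨1, mem_filter.2 ⟨mem_univ _, by simp⟩⟩
    exact_mod_cast card_pos.2 this
  have hN : (0 : ℝ) < (fpfInvolutions n).card := by exact_mod_cast card_pos.2 ⟨s, hs⟩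
  field_simp

/-! ## §7 The matching-side level-`k` inequality, modulo Keevash–Lifshitz Theorem 1.8 -/

/-- `Σ_{σ ∈ Ỹ} G_p(σ) = |C(s)| · Σ_{π ∈ Y} Π_p(π)`: the left side of Theorem 1.8's dual form for `(Ỹ, G_p)`.
[cite: KeevashLifshitz2023, Thm. 1.8] -/
theorem sum_pullback_pullVec (s : Perm (Fin n)) (hs : s ∈ fpfInvolutions n) {Y : Finset (Perm (Fin n))}
    (hY : Y ⊆ fpfInvolutions n) (k : ℕ) (p : Finset (Fin n) → ℝ) :
    ∑ σ ∈ pullback s Y, pullVec s k p σ = ((transporters s s).card : ℝ) * ∑ π ∈ Y, closedSum k p π := by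
  rw [← sum_filter_conj_mem s hs hY (closedSum k p)]
  rfl

/-- `‖G_p‖² = |C(s)| · Σ_{π ∈ PM_n} Π_p(π)²`: the test-vector norm in Theorem 1.8's dual form for `(Ỹ, G_p)`.
[cite: KeevashLifshitz2023, Thm. 1.8] -/
theorem norm_pullVec_sq (s : Perm (Fin n)) (hs : s ∈ fpfInvolutions n) (k : ℕ) (p : Finset (Fin n) → ℝ) :
    ‖pullVec s k p‖ ^ 2 = ((transporters s s).card : ℝ) * ∑ π ∈ fpfInvolutions n, closedSum k p π ^ 2 := by
  rw [norm_sq_eq_sum, ← sum_filter_conj_mem s hs (subset_refl _) (fun π => closedSum k p π ^ 2)]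
  have : univ.filter (fun σ : Perm (Fin n) => σ * s * σ⁻¹ ∈ fpfInvolutions n) = univ :=
    eq_univ_of_forall fun σ => mem_filter.2 ⟨mem_univ _, conj_mem_fpfInvolutions hs σ⟩
  rw [this]
  rfl

/-- **THE MATCHING-SIDE LEVEL-`k` INEQUALITY (modulo Keevash–Lifshitz Thm 1.8).** Let `s` be a perfect
matching of `[n]` (a fixed-point-free involution), `Y ⊆ PM_n` a set of perfect matchings whose pull-back
`Ỹ = {σ ∈ S_n : σ s σ⁻¹ ∈ Y}` is `r`-global (Def. 1.6), `ν = |Y|/|PM_n|` (`= |Ỹ|/n!`), and `p` a harmonic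
coefficient vector of degree `k` with `1 ≤ k ≤ min(⅛ log(1/ν), 10⁻⁵ n)`. Then the matching-side functional
`Π_p(π) = Σ_{T π-closed, |T| = k} p_T` of the cell's bi-mode expansion satisfies
`(Σ_{π ∈ Y} Π_p(π))² ≤ ν² · (C r⁴ k⁻¹ log(1/ν))^k · |PM_n| · Σ_{π ∈ PM_n} Π_p(π)²`
with the absolute constant `C` of Theorem 1.8 — versus the trivial Cauchy–Schwarz bound
`ν · |PM_n| · Σ_π Π_p(π)²`: the gain `ν (C r⁴ k⁻¹ log(1/ν))^k` is the level-`k` inequality.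
Proof: `G_p = Π_p(σ s σ⁻¹)` is a pure degree-`k` function on `S_n` (§4–§5), so Theorem 1.8 in its dual
form applies to `⟨1_Ỹ, G_p⟩`; the fibres of `σ ↦ σ s σ⁻¹` all have size `|C(s)|` (§6), which cancels.
[cite: KeevashLifshitz2023, Thm. 1.8] -/
theorem closedSum_sq_le (h : GlobalLevelDInequality) :
    ∃ C : ℝ, 0 < C ∧ ∀ (n : ℕ) (s : Perm (Fin n)), s ∈ fpfInvolutions n →
      ∀ (Y : Finset (Perm (Fin n))), Y ⊆ fpfInvolutions n →
      ∀ (r : ℝ) (k : ℕ) (p : Finset (Fin n) → ℝ), 1 ≤ k → IsHarmonic k p →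
      IsGlobal r (pullback s Y) →
      (k : ℝ) ≤ Real.log (1 / ((Y.card : ℝ) / (fpfInvolutions n).card)) / 8 →
      (k : ℝ) ≤ (n : ℝ) / 10 ^ 5 →
      (∑ π ∈ Y, closedSum k p π) ^ 2 ≤
        ((Y.card : ℝ) / (fpfInvolutions n).card) ^ 2 *
          (C * r ^ 4 * (1 / (k : ℝ)) * Real.log (1 / ((Y.card : ℝ) / (fpfInvolutions n).card))) ^ k *
          ((fpfInvolutions n).card * ∑ π ∈ fpfInvolutions n, closedSum k p π ^ 2) := by
  obtain ⟨C, hC, hdual⟩ := h.dual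
  refine ⟨C, hC, fun n s hs Y hY r k p hk hp hglob h8 hn => ?_⟩
  have hdens := card_pullback_div s hs hY
  have hmain := hdual n (pullback s Y) r k (pullVec s k p) hk hglob (by rw [hdens]; exact h8) hn
    (pullVec_mem_degLE s k p) (fun w hw => inner_pullVec_eq_zero_of_mem_degLE (by omega) s hp hw)
  rw [hdens, sum_pullback_pullVec s hs hY, norm_pullVec_sq s hs, factorial_eq_card_mul s hs] at hmain
  set c : ℝ := ((transporters s s).card : ℝ) with hc_def
  have hc : (0 : ℝ) < c := by
    have : (transporters s s).Nonempty := ⟨1, mem_filter.2 ⟨mem_univ _, by simp⟩⟩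
    rw [hc_def]; exact_mod_cast card_pos.2 this
  set A : ℝ := ∑ π ∈ Y, closedSum k p π
  set B : ℝ := ∑ π ∈ fpfInvolutions n, closedSum k p π ^ 2
  set N : ℝ := ((fpfInvolutions n).card : ℝ)
  set K : ℝ := ((Y.card : ℝ) / N) ^ 2 * (C * r ^ 4 * (1 / (k : ℝ)) * Real.log (1 / ((Y.card : ℝ) / N))) ^ k
  -- `hmain : (c A)² ≤ c B · (c N) · K`; divide by `c² > 0`
  have h' : c ^ 2 * A ^ 2 ≤ c ^ 2 * (K * (N * B)) := by
    calc c ^ 2 * A ^ 2 = (c * A) ^ 2 := by ring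
      _ ≤ c * B * (c * N) * K := hmain
      _ = c ^ 2 * (K * (N * B)) := by ring
  exact le_of_mul_le_mul_left h' (by positivity)

/-! ## §8 Homogeneous families of perfect matchings pull back to global sets

The transfer «`Y` `τ`-homogeneous (Kupavskii–Zakharov, w.r.t. partial matchings) ⇒ `Ỹ = pullback s Y` is
`√τ`-global (Keevash–Lifshitz Def. 1.6)» (planner p1, N2-SpreadStructure §SNT (1): «an `s`-umvirate conditions `M`
on `≤ s/2` forced edges»; here with the exact exponent: refining an umvirate by the values on the `s`-closure of
its pinned positions forces at most `d` edges, so NO `(1 + O(s²/n))` correction and no density side condition). -/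

/-- Evaluation of `Equiv.subtypeCongr` on the first subtype. [folklore] -/
private theorem subtypeCongr_apply_of_pos {α : Type*} {p q : α → Prop} [DecidablePred p] [DecidablePred q]
    (e : {x // p x} ≃ {x // q x}) (f : {x // ¬ p x} ≃ {x // ¬ q x}) {x : α} (hx : p x) :
    e.subtypeCongr f x = e ⟨x, hx⟩ := by
  simp [Equiv.subtypeCongr, hx]

/-- Evaluation of `Equiv.subtypeCongr` on the complement. [folklore] -/
private theorem subtypeCongr_apply_of_neg {α : Type*} {p q : α → Prop} [DecidablePred p] [DecidablePred q]
    (e : {x // p x} ≃ {x // q x}) (f : {x // ¬ p x} ≃ {x // ¬ q x}) {x : α} (hx : ¬ p x) :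
    e.subtypeCongr f x = f ⟨x, hx⟩ := by
  simp [Equiv.subtypeCongr, hx]

/-- A fixed-point-free involution transported along an equivalence with `Fin m` is a fixed-point-free
involution of `Fin m`. [folklore] -/
private theorem permCongr_mem_fpfInvolutions {α : Type*} {m : ℕ} (e : α ≃ Fin m) (τ : Perm α)
    (h1 : ∀ x, τ (τ x) = x) (h2 : ∀ x, τ x ≠ x) : e.permCongr τ ∈ fpfInvolutions m := by
  rw [mem_fpfInvolutions]
  refine ⟨?_, fun y hy => ?_⟩
  · ext y
    simp [Equiv.permCongr_apply, h1]
  · rw [Equiv.permCongr_apply] at hy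
    have := congrArg e.symm hy
    rw [Equiv.symm_apply_apply] at this
    exact h2 _ this

/-- **Umvirates with a matching-closed pin set surject onto their star.** Let `s` be a perfect matching
(fixed-point-free involution), `P` an `s`-closed set of positions, `g` injective on `P`, and `π` a perfect
matching containing the forced edges `{g x, g(s x)}` (`x ∈ P`). Then some `σ` with `σ|_P = g|_P`
transports `s` to `π`: `σ s σ⁻¹ = π`. [cite: GodsilMeagher2015, §15.2 (perfect matchings as one orbit; stabilisers)] -/
theorem exists_pin_conj_eq {s : Perm (Fin n)} (hs : s ∈ fpfInvolutions n) {P : Finset (Fin n)}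
    (hP : ∀ x ∈ P, s x ∈ P) {g : Fin n → Fin n} (hg : Set.InjOn g P) {π : Perm (Fin n)}
    (hπ : π ∈ fpfInvolutions n) (hπg : ∀ x ∈ P, π (g x) = g (s x)) :
    ∃ σ : Perm (Fin n), (∀ x ∈ P, σ x = g x) ∧ σ * s * σ⁻¹ = π := by
  classical
  obtain ⟨hs1, hs2⟩ := mem_fpfInvolutions.1 hs
  obtain ⟨hπ1, hπ2⟩ := mem_fpfInvolutions.1 hπ
  have hss : ∀ x, s (s x) = x := fun x => by
    have := congrArg (fun τ : Perm (Fin n) => τ x) hs1; simpa [Perm.mul_apply] using this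
  have hππ : ∀ y, π (π y) = y := fun y => by
    have := congrArg (fun τ : Perm (Fin n) => τ y) hπ1; simpa [Perm.mul_apply] using this
  set Q : Finset (Fin n) := P.image g with hQ
  have hQcl : ∀ y ∈ Q, π y ∈ Q := by
    intro y hy
    obtain ⟨x, hx, rfl⟩ := mem_image.1 hy
    rw [hπg x hx]; exact mem_image_of_mem _ (hP x hx)
  -- closure of the complements
  have hPc : ∀ x, x ∉ P ↔ s x ∉ P := by
    intro x; constructor
    · intro hx hsx; exact hx (by simpa [hss] using hP _ hsx)
    · intro hsx hx; exact hsx (hP x hx)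
  have hQc : ∀ y, y ∉ Q ↔ π y ∉ Q := by
    intro y; constructor
    · intro hy hpy; exact hy (by simpa [hππ] using hQcl _ hpy)
    · intro hpy hy; exact hpy (hQcl y hy)
  -- the pinned part: `e : P ≃ Q`, `x ↦ g x`
  have hbij : Set.BijOn g (↑P : Set (Fin n)) (↑Q : Set (Fin n)) := by
    rw [hQ, coe_image]; exact hg.bijOn_image
  let e : {x // x ∈ P} ≃ {y // y ∈ Q} := hbij.equiv g
  have he : ∀ x (hx : x ∈ P), (e ⟨x, hx⟩ : Fin n) = g x := fun x hx => rfl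
  -- the free part: conjugate the restrictions of `s` and `π` to the complements
  let s' : Perm {x // x ∉ P} := s.subtypePerm (fun x => (hPc x).symm)
  let π' : Perm {y // y ∉ Q} := π.subtypePerm (fun y => (hQc y).symm)
  have hcardP : Fintype.card {x // x ∉ P} = n - P.card := by
    rw [Fintype.card_subtype_compl, Fintype.card_fin]; simp
  have hcardQ : Fintype.card {y // y ∉ Q} = n - P.card := by
    rw [Fintype.card_subtype_compl, Fintype.card_fin, Fintype.card_coe, hQ, card_image_of_injOn hg]
  let eα : {x // x ∉ P} ≃ Fin (n - P.card) := Fintype.equivFinOfCardEq hcardP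
  let eβ : {y // y ∉ Q} ≃ Fin (n - P.card) := Fintype.equivFinOfCardEq hcardQ
  have hs'' : eα.permCongr s' ∈ fpfInvolutions (n - P.card) :=
    permCongr_mem_fpfInvolutions eα s' (fun x => Subtype.ext (by simp [s', hss]))
      (fun x hx => hs2 x (by simpa [s'] using congrArg Subtype.val hx))
  have hπ'' : eβ.permCongr π' ∈ fpfInvolutions (n - P.card) :=
    permCongr_mem_fpfInvolutions eβ π' (fun y => Subtype.ext (by simp [π', hππ]))
      (fun y hy => hπ2 y (by simpa [π'] using congrArg Subtype.val hy))
  obtain ⟨c, hc⟩ := exists_conj_eq hs'' hπ''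
  let f : {x // x ∉ P} ≃ {y // y ∉ Q} := eα.trans (c.trans eβ.symm)
  -- `f` intertwines `s'` and `π'`
  have hf : ∀ x : {x // x ∉ P}, f (s' x) = π' (f x) := by
    intro x
    have hc' : ∀ z, c (eα.permCongr s' z) = eβ.permCongr π' (c z) := by
      intro z
      have := congrArg (fun τ : Perm (Fin (n - P.card)) => τ (c z)) hc
      simpa [Perm.mul_apply] using this
    have h1 := hc' (eα x)
    simp only [Equiv.permCongr_apply, Equiv.symm_apply_apply] at h1
    show eβ.symm (c (eα (s' x))) = π' (eβ.symm (c (eα x)))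
    rw [h1, Equiv.symm_apply_apply]
  -- glue
  refine ⟨e.subtypeCongr f, fun x hx => by rw [subtypeCongr_apply_of_pos e f hx]; exact he x hx, ?_⟩
  rw [mul_inv_eq_iff_eq_mul]
  ext y
  rw [Perm.mul_apply, Perm.mul_apply]
  by_cases hy : y ∈ P
  · rw [subtypeCongr_apply_of_pos e f (hP y hy), subtypeCongr_apply_of_pos e f hy, he, he, hπg y hy]
  · rw [subtypeCongr_apply_of_neg e f ((hPc y).1 hy), subtypeCongr_apply_of_neg e f hy]
    have := hf ⟨y, hy⟩
    have h2 : (s' ⟨y, hy⟩ : {x // x ∉ P}) = ⟨s y, (hPc y).1 hy⟩ := Subtype.ext (by simp [s'])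
    rw [h2] at this
    rw [this]
    simp [π']

/-- **Pin sets** `{σ ∈ S_n : σ|_P = g|_P}` — the umvirates, indexed by a set of positions and a map
(for injective `I, J : Fin d → Fin n`, `U_{I→J}` is the pin set of `P = I([d])` and any `g` with `g ∘ I = J`).
[cite: KeevashLifshitz2023, §1.2 (p. 4, umvirates)] -/
def pinSet (P : Finset (Fin n)) (g : Fin n → Fin n) : Finset (Perm (Fin n)) :=
  univ.filter (fun σ => ∀ x ∈ P, σ x = g x)

/-- [cite: KeevashLifshitz2023, §1.2 (p. 4)] -/
theorem mem_pinSet {P : Finset (Fin n)} {g : Fin n → Fin n} {σ : Perm (Fin n)} :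
    σ ∈ pinSet P g ↔ ∀ x ∈ P, σ x = g x := by
  simp [pinSet]

/-- The **star** of the partial matching forced by an `s`-closed pin set: the perfect matchings `π` with
`π(g x) = g(s x)` for `x ∈ P`. [cite: KupavskiiZakharov2022, §2 (the families `ℱ(T)`, `⟨T⟩`)] -/
def pinStar (s : Perm (Fin n)) (P : Finset (Fin n)) (g : Fin n → Fin n) : Finset (Perm (Fin n)) :=
  (fpfInvolutions n).filter (fun π => ∀ x ∈ P, π (g x) = g (s x))

/-- The transported matching of a pinned permutation lies in the star. [folklore] -/
private theorem conj_mem_pinStar {s : Perm (Fin n)} (hs : s ∈ fpfInvolutions n) {P : Finset (Fin n)}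
    (hP : ∀ x ∈ P, s x ∈ P) {g : Fin n → Fin n} {σ : Perm (Fin n)} (hσ : σ ∈ pinSet P g) :
    σ * s * σ⁻¹ ∈ pinStar s P g := by
  rw [pinStar, mem_filter]
  refine ⟨conj_mem_fpfInvolutions hs σ, fun x hx => ?_⟩
  rw [mem_pinSet] at hσ
  rw [← hσ x hx]
  simp [Perm.mul_apply, hσ (s x) (hP x hx)]

/-- The centraliser of `s` inside the pointwise stabiliser of `P`. [folklore] -/
def pinCentraliser (s : Perm (Fin n)) (P : Finset (Fin n)) : Finset (Perm (Fin n)) :=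
  univ.filter (fun c => c * s * c⁻¹ = s ∧ ∀ x ∈ P, c x = x)

/-- **Fibres inside a pin set are cosets of `C(s) ∩ Fix(P)`**: every nonempty fibre of `σ ↦ σ s σ⁻¹` on
`pinSet P g` has exactly `|pinCentraliser s P|` elements. [cite: GodsilMeagher2015, §15.2 (stabilisers of perfect matchings)] -/
theorem card_pinSet_fibre {s π : Perm (Fin n)} {P : Finset (Fin n)} {g : Fin n → Fin n}
    (hne : ((pinSet P g).filter (fun σ => σ * s * σ⁻¹ = π)).Nonempty) :
    ((pinSet P g).filter (fun σ => σ * s * σ⁻¹ = π)).card = (pinCentraliser s P).card := by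
  obtain ⟨σ₁, hσ₁⟩ := hne
  rw [mem_filter, mem_pinSet] at hσ₁
  symm
  refine card_nbij' (fun c => σ₁ * c) (fun σ => σ₁⁻¹ * σ) ?_ ?_ ?_ ?_
  · intro c hc
    rw [mem_coe, pinCentraliser, mem_filter] at hc
    rw [mem_coe, mem_filter, mem_pinSet]
    refine ⟨fun x hx => ?_, ?_⟩
    · rw [Perm.mul_apply, hc.2.2 x hx, hσ₁.1 x hx]
    · rw [show σ₁ * c * s * (σ₁ * c)⁻¹ = σ₁ * (c * s * c⁻¹) * σ₁⁻¹ by group, hc.2.1, hσ₁.2]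
  · intro σ hσ
    rw [mem_coe, mem_filter, mem_pinSet] at hσ
    rw [mem_coe, pinCentraliser, mem_filter]
    refine ⟨mem_univ _, ?_, fun x hx => ?_⟩
    · rw [show σ₁⁻¹ * σ * s * (σ₁⁻¹ * σ)⁻¹ = σ₁⁻¹ * (σ * s * σ⁻¹) * σ₁ by group, hσ.2, ← hσ₁.2]; group
    · rw [Perm.mul_apply, hσ.1 x hx, ← hσ₁.1 x hx]; simp
  · intro c _; simp
  · intro σ _; simp

/-- **Push-forward along `σ ↦ σ s σ⁻¹` from an `s`-closed pin set**: for `Y ⊆ PM_n`,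
`Σ_{σ ∈ pinSet, σsσ⁻¹ ∈ Y} G(σsσ⁻¹) = |C(s) ∩ Fix(P)| · Σ_{π ∈ Y ∩ star} G(π)`.
[cite: GodsilMeagher2015, §15.2 (perfect matchings as a coset space)] -/
theorem sum_pinSet_conj {s : Perm (Fin n)} (hs : s ∈ fpfInvolutions n) {P : Finset (Fin n)}
    (hP : ∀ x ∈ P, s x ∈ P) {g : Fin n → Fin n} (hg : Set.InjOn g P) (Y : Finset (Perm (Fin n)))
    (G : Perm (Fin n) → ℝ) :
    ∑ σ ∈ (pinSet P g).filter (fun σ : Perm (Fin n) => σ * s * σ⁻¹ ∈ Y), G (σ * s * σ⁻¹) =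
      ((pinCentraliser s P).card : ℝ) * ∑ π ∈ Y ∩ pinStar s P g, G π := by
  classical
  rw [mul_sum]
  rw [← sum_fiberwise_of_maps_to (s := (pinSet P g).filter (fun σ : Perm (Fin n) => σ * s * σ⁻¹ ∈ Y))
    (t := Y ∩ pinStar s P g) (g := fun σ => σ * s * σ⁻¹)
    (fun σ hσ => mem_inter.2 ⟨(mem_filter.1 hσ).2, conj_mem_pinStar hs hP (mem_filter.1 hσ).1⟩)]
  refine sum_congr rfl fun π hπ => ?_
  have hfib : ((pinSet P g).filter (fun σ : Perm (Fin n) => σ * s * σ⁻¹ ∈ Y)).filter (fun σ => σ * s * σ⁻¹ = π) =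
      (pinSet P g).filter (fun σ => σ * s * σ⁻¹ = π) := by
    ext σ
    simp only [mem_filter]
    constructor
    · exact fun h => ⟨h.1.1, h.2⟩
    · intro h; exact ⟨⟨h.1, by rw [h.2]; exact (mem_inter.1 hπ).1⟩, h.2⟩
  rw [hfib]
  have hval : ∀ σ ∈ (pinSet P g).filter (fun σ => σ * s * σ⁻¹ = π), G (σ * s * σ⁻¹) = G π := by
    intro σ hσ; rw [(mem_filter.1 hσ).2]
  rw [sum_congr rfl hval, sum_const, nsmul_eq_mul]
  congr 1
  -- the fibre over `π ∈ star` is nonempty by the surjectivity theorem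
  have hπ' := (mem_inter.1 hπ).2
  rw [pinStar, mem_filter] at hπ'
  obtain ⟨σ, hσP, hσπ⟩ := exists_pin_conj_eq hs hP hg hπ'.1 hπ'.2
  exact_mod_cast card_pinSet_fibre ⟨σ, mem_filter.2 ⟨mem_pinSet.2 hσP, hσπ⟩⟩

/-- `|pinSet| = |C(s) ∩ Fix(P)| · |star|` for an `s`-closed pin set. [cite: GodsilMeagher2015, §15.2] -/
theorem card_pinSet_eq {s : Perm (Fin n)} (hs : s ∈ fpfInvolutions n) {P : Finset (Fin n)}
    (hP : ∀ x ∈ P, s x ∈ P) {g : Fin n → Fin n} (hg : Set.InjOn g P) :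
    ((pinSet P g).card : ℝ) = ((pinCentraliser s P).card : ℝ) * (pinStar s P g).card := by
  have h := sum_pinSet_conj hs hP hg (fpfInvolutions n) (fun _ => (1 : ℝ))
  rw [sum_const, sum_const, nsmul_eq_mul, nsmul_eq_mul, mul_one, mul_one] at h
  have h1 : (pinSet P g).filter (fun σ : Perm (Fin n) => σ * s * σ⁻¹ ∈ fpfInvolutions n) = pinSet P g :=
    filter_true_of_mem fun σ _ => conj_mem_fpfInvolutions hs σ
  have h2 : fpfInvolutions n ∩ pinStar s P g = pinStar s P g := inter_eq_right.2 (filter_subset _ _)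
  rw [h1, h2] at h
  exact h

/-- `|Ỹ ∩ pinSet| = |C(s) ∩ Fix(P)| · |Y ∩ star|` for an `s`-closed pin set. [cite: GodsilMeagher2015, §15.2] -/
theorem card_pullback_inter_pinSet_eq {s : Perm (Fin n)} (hs : s ∈ fpfInvolutions n) {P : Finset (Fin n)}
    (hP : ∀ x ∈ P, s x ∈ P) {g : Fin n → Fin n} (hg : Set.InjOn g P) (Y : Finset (Perm (Fin n))) :
    (((pinSet P g).filter (fun σ : Perm (Fin n) => σ * s * σ⁻¹ ∈ Y)).card : ℝ) =
      ((pinCentraliser s P).card : ℝ) * (Y ∩ pinStar s P g).card := by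
  have h := sum_pinSet_conj hs hP hg Y (fun _ => (1 : ℝ))
  rw [sum_const, sum_const, nsmul_eq_mul, nsmul_eq_mul, mul_one, mul_one] at h
  exact h

/-! ### Homogeneous families of perfect matchings -/

/-- **`τ`-homogeneity of a family `Y` of perfect matchings** (Kupavskii–Zakharov's notion for the family
of perfect matchings, written with partner maps): for every partial matching — a set `D` of vertices with a
fixed-point-free involution `φ` of `D`, i.e. `|D|/2` disjoint edges `{x, φ x}` — the density of `Y` among
the perfect matchings CONTAINING these edges is at most `τ^{|D|/2}` times its density among all perfect
matchings: `|Y ∩ ⟨F⟩| · |PM_n| ≤ τ^{|F|} · |Y| · |⟨F⟩|` (cleared denominators).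
[cite: KupavskiiZakharov2022, §2 (τ-homogeneous families: `|ℱ(T)| ≤ τ^{|T|} |ℱ| |𝒜(T)|/|𝒜|`)] -/
def IsHomogeneousMatchingFamily (τ : ℝ) (Y : Finset (Perm (Fin n))) : Prop :=
  ∀ (D : Finset (Fin n)) (φ : Fin n → Fin n), (∀ x ∈ D, φ x ∈ D) → (∀ x ∈ D, φ (φ x) = x) →
    (∀ x ∈ D, φ x ≠ x) →
    ((Y.filter (fun π : Perm (Fin n) => ∀ x ∈ D, π x = φ x)).card : ℝ) * (fpfInvolutions n).card ≤
      τ ^ (D.card / 2) * Y.card * ((fpfInvolutions n).filter (fun π : Perm (Fin n) => ∀ x ∈ D, π x = φ x)).card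

/-- The star of an `s`-closed pin set is the star of a partial matching with `|P|/2` edges, so a
`τ`-homogeneous family has density `≤ τ^{|P|/2} ν` in it. [cite: KupavskiiZakharov2022, §2] -/
theorem card_inter_pinStar_le {τ : ℝ} {Y : Finset (Perm (Fin n))} (hYh : IsHomogeneousMatchingFamily τ Y)
    (hY : Y ⊆ fpfInvolutions n) {s : Perm (Fin n)} (hs : s ∈ fpfInvolutions n) {P : Finset (Fin n)}
    (hP : ∀ x ∈ P, s x ∈ P) {g : Fin n → Fin n} (hg : Set.InjOn g P) :
    ((Y ∩ pinStar s P g).card : ℝ) * (fpfInvolutions n).card ≤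
      τ ^ (P.card / 2) * Y.card * (pinStar s P g).card := by
  classical
  obtain ⟨hs1, hs2⟩ := mem_fpfInvolutions.1 hs
  have hss : ∀ x, s (s x) = x := fun x => by
    have := congrArg (fun τ : Perm (Fin n) => τ x) hs1; simpa [Perm.mul_apply] using this
  -- the forced partial matching on `D = g(P)`
  set D : Finset (Fin n) := P.image g with hD
  let φ : Fin n → Fin n := fun y => if h : ∃ x ∈ P, g x = y then g (s h.choose) else y
  have hφ : ∀ x ∈ P, φ (g x) = g (s x) := by
    intro x hx
    have h : ∃ x' ∈ P, g x' = g x := ⟨x, hx, rfl⟩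
    simp only [φ, dif_pos h]
    have hx' : h.choose = x := hg h.choose_spec.1 hx h.choose_spec.2
    rw [hx']
  have hD1 : ∀ y ∈ D, φ y ∈ D := by
    intro y hy; obtain ⟨x, hx, rfl⟩ := mem_image.1 hy
    rw [hφ x hx]; exact mem_image_of_mem _ (hP x hx)
  have hD2 : ∀ y ∈ D, φ (φ y) = y := by
    intro y hy; obtain ⟨x, hx, rfl⟩ := mem_image.1 hy
    rw [hφ x hx, hφ (s x) (hP x hx), hss]
  have hD3 : ∀ y ∈ D, φ y ≠ y := by
    intro y hy; obtain ⟨x, hx, rfl⟩ := mem_image.1 hy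
    rw [hφ x hx]
    intro h
    exact hs2 x (hg (hP x hx) hx h)
  have hstar : ∀ π : Perm (Fin n), (∀ y ∈ D, π y = φ y) ↔ (∀ x ∈ P, π (g x) = g (s x)) := by
    intro π; constructor
    · intro h x hx; rw [h (g x) (mem_image_of_mem _ hx), hφ x hx]
    · intro h y hy; obtain ⟨x, hx, rfl⟩ := mem_image.1 hy; rw [h x hx, hφ x hx]
  have hcardD : D.card = P.card := card_image_of_injOn hg
  have hmain := hYh D φ hD1 hD2 hD3
  have e1 : Y.filter (fun π : Perm (Fin n) => ∀ y ∈ D, π y = φ y) = Y ∩ pinStar s P g := by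
    ext π
    simp only [mem_filter, mem_inter, pinStar, hstar]
    constructor
    · intro h; exact ⟨h.1, hY h.1, h.2⟩
    · intro h; exact ⟨h.1, h.2.2⟩
  have e2 : (fpfInvolutions n).filter (fun π : Perm (Fin n) => ∀ y ∈ D, π y = φ y) = pinStar s P g := by
    ext π
    simp only [mem_filter, pinStar, hstar]
  rw [e1, e2, hcardD] at hmain
  exact hmain

/-- **Density of the pull-back on an `s`-closed pin set**: `|Ỹ ∩ pinSet|·|PM_n| ≤ τ^{|P|/2} |Y| |pinSet|`.
[cite: KeevashLifshitz2023, Def. 1.6] -/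
theorem card_pullback_inter_pinSet_le_closed {τ : ℝ} {Y : Finset (Perm (Fin n))}
    (hYh : IsHomogeneousMatchingFamily τ Y) (hY : Y ⊆ fpfInvolutions n) {s : Perm (Fin n)}
    (hs : s ∈ fpfInvolutions n) {P : Finset (Fin n)} (hP : ∀ x ∈ P, s x ∈ P) {g : Fin n → Fin n}
    (hg : Set.InjOn g P) :
    (((pinSet P g).filter (fun σ : Perm (Fin n) => σ * s * σ⁻¹ ∈ Y)).card : ℝ) * (fpfInvolutions n).card ≤
      τ ^ (P.card / 2) * Y.card * (pinSet P g).card := by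
  rw [card_pullback_inter_pinSet_eq hs hP hg Y, card_pinSet_eq hs hP hg]
  have hK : (0 : ℝ) ≤ (pinCentraliser s P).card := by positivity
  have := card_inter_pinStar_le hYh hY hs hP hg
  calc ((pinCentraliser s P).card : ℝ) * (Y ∩ pinStar s P g).card * (fpfInvolutions n).card
      = (pinCentraliser s P).card * (((Y ∩ pinStar s P g).card : ℝ) * (fpfInvolutions n).card) := by ring
    _ ≤ (pinCentraliser s P).card * (τ ^ (P.card / 2) * Y.card * (pinStar s P g).card) :=
        mul_le_mul_of_nonneg_left this hK
    _ = τ ^ (P.card / 2) * Y.card * ((pinCentraliser s P).card * (pinStar s P g).card) := by ring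

/-- **Density of the pull-back on an arbitrary pin set** (`g` injective on `P`): refining by the values on the
`s`-closure `P ∪ s(P)` (at most `|P|` forced edges) gives `|Ỹ ∩ pinSet P g| · |PM_n| ≤ τ^{|P|} |Y| |pinSet P g|`
for `τ ≥ 1`. [cite: KeevashLifshitz2023, Def. 1.6] -/
theorem card_pullback_inter_pinSet_le {τ : ℝ} (hτ : 1 ≤ τ) {Y : Finset (Perm (Fin n))}
    (hYh : IsHomogeneousMatchingFamily τ Y) (hY : Y ⊆ fpfInvolutions n) {s : Perm (Fin n)}
    (hs : s ∈ fpfInvolutions n) (P : Finset (Fin n)) (g : Fin n → Fin n) :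
    (((pinSet P g).filter (fun σ : Perm (Fin n) => σ * s * σ⁻¹ ∈ Y)).card : ℝ) * (fpfInvolutions n).card ≤
      τ ^ P.card * Y.card * (pinSet P g).card := by
  classical
  obtain ⟨hs1, hs2⟩ := mem_fpfInvolutions.1 hs
  have hss : ∀ x, s (s x) = x := fun x => by
    have := congrArg (fun τ : Perm (Fin n) => τ x) hs1; simpa [Perm.mul_apply] using this
  set P' : Finset (Fin n) := P ∪ P.image s with hP'
  have hP'cl : ∀ x ∈ P', s x ∈ P' := by
    intro x hx
    rcases mem_union.1 hx with h | h
    · exact mem_union.2 (Or.inr (mem_image_of_mem _ h))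
    · obtain ⟨y, hy, rfl⟩ := mem_image.1 h
      rw [hss]; exact mem_union.2 (Or.inl hy)
  have hPP' : P ⊆ P' := subset_union_left
  have hcardP' : P'.card / 2 ≤ P.card := by
    have : P'.card ≤ P.card + P.card := (card_union_le P (P.image ⇑s)).trans (Nat.add_le_add_left card_image_le _)
    omega
  -- the key of a permutation: its values on `P'`
  let key : Perm (Fin n) → (Fin n → Fin n) := fun σ x => if x ∈ P' then σ x else x
  have hfibre : ∀ σ₀ ∈ pinSet P g,
      (pinSet P g).filter (fun σ : Perm (Fin n) => key σ = key σ₀) = pinSet P' (key σ₀) := by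
    intro σ₀ hσ₀
    rw [mem_pinSet] at hσ₀
    ext σ
    simp only [mem_filter, mem_pinSet]
    constructor
    · rintro ⟨-, hk⟩ x hx
      have := congrFun hk x
      simp only [key, if_pos hx] at this
      simp only [key, if_pos hx]
      exact this
    · intro h
      have hk : key σ = key σ₀ := by
        funext x
        by_cases hx : x ∈ P'
        · have := h x hx; simp only [key, if_pos hx] at this ⊢; exact this
        · simp only [key, if_neg hx]
      refine ⟨fun x hx => ?_, hk⟩
      have := h x (hPP' hx)
      simp only [key, if_pos (hPP' hx)] at this
      rw [this, hσ₀ x hx]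
  have hinj : ∀ σ₀ : Perm (Fin n), Set.InjOn (key σ₀) P' := by
    intro σ₀ x hx y hy hxy
    simp only [key, if_pos (mem_coe.1 hx), if_pos (mem_coe.1 hy)] at hxy
    exact σ₀.injective hxy
  -- sum over the classes
  have hτ0 : (0 : ℝ) ≤ τ := zero_le_one.trans hτ
  set T := (pinSet P g).image key with hT
  have hL : (((pinSet P g).filter (fun σ : Perm (Fin n) => σ * s * σ⁻¹ ∈ Y)).card : ℝ) =
      ∑ κ ∈ T, ((((pinSet P g).filter (fun σ : Perm (Fin n) => key σ = κ)).filter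
        (fun σ : Perm (Fin n) => σ * s * σ⁻¹ ∈ Y)).card : ℝ) := by
    have hU : (pinSet P g).filter (fun σ : Perm (Fin n) => σ * s * σ⁻¹ ∈ Y) =
        T.biUnion (fun κ => ((pinSet P g).filter (fun σ : Perm (Fin n) => key σ = κ)).filter
          (fun σ : Perm (Fin n) => σ * s * σ⁻¹ ∈ Y)) := by
      ext σ
      simp only [mem_filter, mem_biUnion, hT, mem_image]
      constructor
      · intro h; exact ⟨key σ, ⟨σ, h.1, rfl⟩, ⟨h.1, rfl⟩, h.2⟩
      · rintro ⟨κ, -, ⟨hσ, -⟩, hY'⟩; exact ⟨hσ, hY'⟩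
    have hdisj : ∀ κ ∈ T, ∀ κ' ∈ T, κ ≠ κ' →
        Disjoint (((pinSet P g).filter (fun σ : Perm (Fin n) => key σ = κ)).filter
            (fun σ : Perm (Fin n) => σ * s * σ⁻¹ ∈ Y))
          (((pinSet P g).filter (fun σ : Perm (Fin n) => key σ = κ')).filter
            (fun σ : Perm (Fin n) => σ * s * σ⁻¹ ∈ Y)) := by
      intro κ _ κ' _ hne
      rw [disjoint_left]
      intro σ h1 h2
      rw [mem_filter, mem_filter] at h1 h2
      exact hne (h1.1.2.symm.trans h2.1.2)
    rw [hU, card_biUnion hdisj, Nat.cast_sum]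
  have hR : ((pinSet P g).card : ℝ) = ∑ κ ∈ T, (((pinSet P g).filter (fun σ : Perm (Fin n) => key σ = κ)).card : ℝ) := by
    rw [← Nat.cast_sum, card_eq_sum_card_image key (pinSet P g)]
  rw [hL, hR, mul_sum, sum_mul]
  refine sum_le_sum fun κ hκ => ?_
  obtain ⟨σ₀, hσ₀, rfl⟩ := mem_image.1 hκ
  rw [hfibre σ₀ hσ₀]
  have h := card_pullback_inter_pinSet_le_closed hYh hY hs hP'cl (hinj σ₀)
  calc ((((pinSet P' (key σ₀)).filter (fun σ : Perm (Fin n) => σ * s * σ⁻¹ ∈ Y)).card : ℝ)) * (fpfInvolutions n).card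
      ≤ τ ^ (P'.card / 2) * Y.card * (pinSet P' (key σ₀)).card := h
    _ ≤ τ ^ P.card * Y.card * (pinSet P' (key σ₀)).card := by
        have hpow : τ ^ (P'.card / 2) ≤ τ ^ P.card := pow_le_pow_right₀ hτ hcardP'
        exact mul_le_mul_of_nonneg_right (mul_le_mul_of_nonneg_right hpow (by positivity)) (by positivity)

/-- The pin map of a pair of tuples: `g(I i) = J i` (junk elsewhere). [cite: KeevashLifshitz2023, §1.2 (p. 4)] -/
def pinMap {d : ℕ} (I J : Fin d → Fin n) : Fin n → Fin n :=
  fun x => if h : ∃ i, I i = x then J h.choose else x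

/-- [cite: KeevashLifshitz2023, §1.2 (p. 4)] -/
theorem pinMap_apply {d : ℕ} {I : Fin d → Fin n} (hI : Function.Injective I) (J : Fin d → Fin n) (i : Fin d) :
    pinMap I J (I i) = J i := by
  have h : ∃ i', I i' = I i := ⟨i, rfl⟩
  simp only [pinMap, dif_pos h]
  rw [hI h.choose_spec]

/-- Umvirates are pin sets: `U_{I→J} = pinSet (I([d])) (pinMap I J)` for injective `I`.
[cite: KeevashLifshitz2023, §1.2 (p. 4)] -/
theorem umvirate_eq_pinSet {d : ℕ} {I : Fin d → Fin n} (hI : Function.Injective I) (J : Fin d → Fin n) :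
    umvirate I J = pinSet (univ.image I) (pinMap I J) := by
  ext σ
  rw [mem_umvirate, mem_pinSet]
  constructor
  · intro h x hx
    obtain ⟨i, -, rfl⟩ := mem_image.1 hx
    rw [h i, pinMap_apply hI]
  · intro h i
    rw [h (I i) (mem_image_of_mem _ (mem_univ i)), pinMap_apply hI]

/-- **Homogeneous ⇒ global.** If `Y ⊆ PM_n` is `τ`-homogeneous (`τ ≥ 1`) then its pull-back
`Ỹ = {σ : σ s σ⁻¹ ∈ Y}` is `√τ`-global in `S_n` (Def. 1.6): restricting to a `d`-umvirate raises the density by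
at most `τ^d = (√τ)^{2d}`. [cite: KeevashLifshitz2023, Def. 1.6] -/
theorem isGlobal_pullback {τ : ℝ} (hτ : 1 ≤ τ) {Y : Finset (Perm (Fin n))} (hYh : IsHomogeneousMatchingFamily τ Y)
    (hY : Y ⊆ fpfInvolutions n) {s : Perm (Fin n)} (hs : s ∈ fpfInvolutions n) :
    IsGlobal (Real.sqrt τ) (pullback s Y) := by
  classical
  intro d I J hI hJ
  have hτ0 : (0 : ℝ) ≤ τ := zero_le_one.trans hτ
  rw [show Real.sqrt τ ^ (2 * d) = τ ^ d by rw [pow_mul, Real.sq_sqrt hτ0]]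
  set U := umvirate I J with hU
  have hUpin : U = pinSet (univ.image I) (pinMap I J) := umvirate_eq_pinSet hI J
  have hd : (univ.image I).card = d := by rw [card_image_of_injective _ hI, card_univ, Fintype.card_fin]
  -- `Ỹ ∩ U` is the pull-back part of the pin set
  have hinter : pullback s Y ∩ U = (pinSet (univ.image I) (pinMap I J)).filter (fun σ : Perm (Fin n) => σ * s * σ⁻¹ ∈ Y) := by
    ext σ
    rw [mem_inter, pullback, mem_filter, mem_filter, hUpin]
    simp only [mem_univ, true_and]
    exact and_comm
  have h5 := card_pullback_inter_pinSet_le hτ hYh hY hs (univ.image I) (pinMap I J)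
  rw [hd, ← hinter, ← hUpin] at h5
  -- multiply by the centraliser order `c`: `n! = c·|PM_n|`, `|Ỹ| = c·|Y|`
  have hc : (0 : ℝ) ≤ ((transporters s s).card : ℝ) := by positivity
  have h6 := mul_le_mul_of_nonneg_right h5 hc
  rw [factorial_eq_card_mul s hs, card_pullback s hs hY]
  calc ((pullback s Y ∩ U).card : ℝ) * (((transporters s s).card : ℝ) * (fpfInvolutions n).card)
      = ((pullback s Y ∩ U).card : ℝ) * (fpfInvolutions n).card * (transporters s s).card := by ring
    _ ≤ τ ^ d * Y.card * U.card * (transporters s s).card := h6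
    _ = τ ^ d * (((transporters s s).card : ℝ) * Y.card) * U.card := by ring

/-- **THE MATCHING-SIDE LEVEL-`k` INEQUALITY FOR HOMOGENEOUS FAMILIES (modulo Keevash–Lifshitz Thm 1.8).**
For `Y ⊆ PM_n` `τ`-homogeneous in the sense of Kupavskii–Zakharov (`τ ≥ 1`), `ν = |Y|/|PM_n|`, and a harmonic
coefficient vector `p` of degree `k` with `1 ≤ k ≤ min(⅛ log(1/ν), 10⁻⁵ n)`:
`(Σ_{π ∈ Y} Π_p(π))² ≤ ν² · (C τ² k⁻¹ log(1/ν))^k · |PM_n| · Σ_{π ∈ PM_n} Π_p(π)²`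
(`C` = the absolute constant of Theorem 1.8; `r⁴ = τ²` for the `√τ`-global pull-back) — the input «(F2)»
of the `r = 1` rung in the kernel's currency. [cite: KeevashLifshitz2023, Thm. 1.8] -/
theorem closedSum_sq_le_of_homogeneous (h : GlobalLevelDInequality) :
    ∃ C : ℝ, 0 < C ∧ ∀ (n : ℕ) (s : Perm (Fin n)), s ∈ fpfInvolutions n →
      ∀ (Y : Finset (Perm (Fin n))), Y ⊆ fpfInvolutions n →
      ∀ (τ : ℝ) (k : ℕ) (p : Finset (Fin n) → ℝ), 1 ≤ τ → IsHomogeneousMatchingFamily τ Y →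
      1 ≤ k → IsHarmonic k p →
      (k : ℝ) ≤ Real.log (1 / ((Y.card : ℝ) / (fpfInvolutions n).card)) / 8 →
      (k : ℝ) ≤ (n : ℝ) / 10 ^ 5 →
      (∑ π ∈ Y, closedSum k p π) ^ 2 ≤
        ((Y.card : ℝ) / (fpfInvolutions n).card) ^ 2 *
          (C * τ ^ 2 * (1 / (k : ℝ)) * Real.log (1 / ((Y.card : ℝ) / (fpfInvolutions n).card))) ^ k *
          ((fpfInvolutions n).card * ∑ π ∈ fpfInvolutions n, closedSum k p π ^ 2) := by
  obtain ⟨C, hC, hmain⟩ := closedSum_sq_le h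
  refine ⟨C, hC, fun n s hs Y hY τ k p hτ hYh hk hp h8 hn => ?_⟩
  have hglob := isGlobal_pullback hτ hYh hY hs
  have := hmain n s hs Y hY (Real.sqrt τ) k p hk hp hglob h8 hn
  have hτ0 : (0 : ℝ) ≤ τ := zero_le_one.trans hτ
  rwa [show Real.sqrt τ ^ 4 = τ ^ 2 by
    rw [show (4 : ℕ) = 2 * 2 by norm_num, pow_mul, Real.sq_sqrt hτ0]] at this

end Literature.Combinatorics.AssociationSchemes.MatchingLevelInequality
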